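import Literature.AlgebraicGeometry.Frobenioids.Thm42PrimesCompatiblePullback
import Literature.AlgebraicGeometry.Frobenioids.BirationalNormalizationExampleRational
import Mathlib.CategoryTheory.Category.Preorder
import Mathlib.CategoryTheory.Functor.Const
import Mathlib.Logic.Equiv.Basic
import HarnessLib

/-!
# Frobenioids I, Theorem 4.2 (ii), sub-DAG slot `FrdI.T42.PrimesCompatibleAlong F₁ F₂ Ψ e γ` ("`Ψ^Prime` is
# compatible with `Prime(Φ₁(−))`, `Prime(Φ₂(−))` along `γ`"): its universal closure is false; the instance form

Mochizuki, *The geometry of Frobenioids I: the general theory*, Kyushu J. Math. **62** (2008) 293–400, §4,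
Theorem 4.2 (ii), proof, kurims text p. 80 l. 34 – p. 81 l. 27 [cite: MochizukiFrdI2008, Thm. 4.2 (ii) p.80]:
"`Ψ^Prime(−)` is compatible (with the evident functoriality of `Prime(Φ₁(−))`, `Prime(Φ₂(−))`) with respect
to morphisms of Frobenius type … pre-steps … pull-back morphisms".

In the tree the compatibility square is the PREDICATE `FrdI.T42.PrimesCompatibleAlong F₁ F₂ Ψ e γ`
(`Thm42SubII.lean`, abc-iut-L1 lineage): for primes `𝔭 ⊆ Φ₁(A)`, `𝔭' ⊆ Φ₁(A')` corresponding under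
`Φ₁(Base γ)`, the primes `e A 𝔭`, `e A' 𝔭'` correspond under `Φ₂(Base (Ψ γ))`.  It is the body-head of the
proved closure facts of rows L09–L11b, e.g. `FrdI.T42.primesCompatibleAlong_of_isPullbackMorphism`
(`Thm42PrimesCompatiblePullback.lean`: in a `Setting F₁ F₂ Ψ`, for every family `e` with the clause of row
L08, along every pull-back morphism `γ`).  The cell's frozen FACT-LIST lists the bare predicate as row F-2651
(class `preparatory`, kernel_closedness `parametrised`, label «model-witness: body-head of a PROVED 0-ary
closure fact»).  Its universal closure — "for ANY structure functors, ANY equivalence, ANY family of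
bijections `e` and ANY arrow `γ`" — is false, and this PROOF-ONLY file (abc-iut cell, block F fact-proving
wave, seat abc-iut-f-012; no definition, no instance) records the kernel census:

* `FrdI.T42.not_forall_primesCompatibleAlong` — ¬∀ over exactly the declaration's binders (universe level
  `0`), from the closed witness `not_primesCompatibleAlong_junk`: over the one-object base `𝟙 = Discrete PUnit`
  with the constant divisor monoid `Φ_M`, `M = ℤ≥0 × ℤ≥0` ([FrdI] Def. 1.1 (iii); `M` has the two DISTINCT
  primes `𝔭 = [(1,0)]`, `𝔮 = [(0,1)]`, abc-iut lineage `Ex46.isPrimary_iff`), take for `C₁ = C₂` the arrow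
  category `Fin 2 = (0 → 1)` with the CONSTANT structure functor at the unique object of `F_{Φ_M}` (so every
  base arrow is an identity and every pull-back is the identity), `Ψ := 𝟭`, `γ := (0 → 1)`, and for the FREE
  family `e` the identity at the object `0` but the transposition `(𝔭 𝔮)` at the object `1`.  The premise holds
  at `(𝔭, 𝔭)`; the conclusion would give a primary element lying in both `𝔮 = e 1 𝔭` and `𝔭 = e 0 𝔭`, i.e.
  `𝔭 = 𝔮`.  What the witness exploits: the family `e` is a free binder (print's `e = Ψ^Prime` is DEFINED from
  `Ψ`); nothing is said about print.
* `FrdI.T42.primesCompatibleAlong_schema_census` — the closure is false AND, by name, the instance form of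
  record holds: `FrdI.T42.primesCompatibleAlong_of_isPullbackMorphism` (every `Setting`, every admissible
  family, every pull-back morphism).

So F-2651 is admissible only as the conclusion it already is (FACT-LIST class «universal-closure REFUTED;
instance form PROVED»).  Elementary; nothing here bears on [IUTchIII] Cor. 3.12 or takes a side; refuted-as-
closure is a statement about OUR typing's binders, not about the paper.
-/

noncomputable section

namespace Literature.AlgebraicGeometry.Frobenioids

open CategoryTheory Opposite

namespace FrdI.T42

/-! ### Two distinct primes of `ℤ≥0 × ℤ≥0` -/

/-- `(1,0)` is a primary element of `ℤ≥0 × ℤ≥0`. [cite: MochizukiFrdI2008, §0 p.12] -/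
theorem isPrimary_ofAdd_one_zero : IsPrimary (Multiplicative.ofAdd ((1 : ℕ), (0 : ℕ))) :=
  (Ex46.isPrimary_iff _).2 (Or.inl ⟨by simp, by simp⟩)

/-- `(0,1)` is a primary element of `ℤ≥0 × ℤ≥0`. [cite: MochizukiFrdI2008, §0 p.12] -/
theorem isPrimary_ofAdd_zero_one : IsPrimary (Multiplicative.ofAdd ((0 : ℕ), (1 : ℕ))) :=
  (Ex46.isPrimary_iff _).2 (Or.inr ⟨by simp, by simp⟩)

/-- The primes of `(1,0)` and of `(0,1)` in `ℤ≥0 × ℤ≥0` are DISTINCT (`(1,0) ⋠ (0,1)`).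
[cite: MochizukiFrdI2008, §0 p.12] -/
theorem prime_one_zero_ne_prime_zero_one :
    (Quotient.mk (primarySetoid (Multiplicative (ℕ × ℕ)))
        ⟨Multiplicative.ofAdd ((1 : ℕ), (0 : ℕ)), isPrimary_ofAdd_one_zero⟩ :
          Primes (Multiplicative (ℕ × ℕ))) ≠
      Quotient.mk (primarySetoid (Multiplicative (ℕ × ℕ)))
        ⟨Multiplicative.ofAdd ((0 : ℕ), (1 : ℕ)), isPrimary_ofAdd_zero_one⟩ := by
  intro h
  have hab : Precsim (Multiplicative.ofAdd ((1 : ℕ), (0 : ℕ))) (Multiplicative.ofAdd ((0 : ℕ), (1 : ℕ))) :=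
    Quotient.exact h
  have := ((Ex46.precsim_iff _ _).1 hab).1 rfl
  simp at this

/-- Two primes sharing an element are equal. [cite: MochizukiFrdI2008, §0 p.12] -/
theorem primes_eq_of_mem_carrier {M : Type} [CommMonoid M] {𝔭 𝔮 : Primes M} {x : M}
    (h𝔭 : x ∈ 𝔭.carrier) (h𝔮 : x ∈ 𝔮.carrier) : 𝔭 = 𝔮 := by
  obtain ⟨hx, rfl⟩ := h𝔭
  obtain ⟨hx', rfl⟩ := h𝔮
  rfl

/-! ### The junk witness -/

/-- **Closed witness**: over the one-object base with the constant divisor monoid `ℤ≥0 × ℤ≥0`, the arrow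
category `Fin 2` with the CONSTANT structure functor, `Ψ := 𝟭`, `γ := (0 → 1)` and the family `e` = identity at
`0`, transposition of the two primes at `1`: the compatibility square FAILS. [cite: MochizukiFrdI2008, Thm. 4.2 (ii) p.80] -/
theorem not_primesCompatibleAlong_junk :
    ¬ PrimesCompatibleAlong
        ((Functor.const (Fin 2)).obj
          (ElemFrobenioid.of (constMonoidOn (Multiplicative (ℕ × ℕ))) ⟨PUnit.unit⟩))
        ((Functor.const (Fin 2)).obj
          (ElemFrobenioid.of (constMonoidOn (Multiplicative (ℕ × ℕ))) ⟨PUnit.unit⟩))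
        (CategoryTheory.Equivalence.refl : Fin 2 ≌ Fin 2)
        (fun A => if A = 0 then Equiv.refl _ else
          @Equiv.swap _ (Classical.decEq _)
            (Quotient.mk (primarySetoid (Multiplicative (ℕ × ℕ)))
              ⟨Multiplicative.ofAdd ((1 : ℕ), (0 : ℕ)), isPrimary_ofAdd_one_zero⟩)
            (Quotient.mk (primarySetoid (Multiplicative (ℕ × ℕ)))
              ⟨Multiplicative.ofAdd ((0 : ℕ), (1 : ℕ)), isPrimary_ofAdd_zero_one⟩))
        (homOfLE (show (0 : Fin 2) ≤ 1 by decide)) := by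
  intro h
  -- the premise at `(𝔭, 𝔭)`, `𝔭 = [(1,0)]`: the base arrow of `γ` is an identity, so the pull-back is the identity
  have hmem : Multiplicative.ofAdd ((1 : ℕ), (0 : ℕ)) ∈
      Primes.carrier (Quotient.mk (primarySetoid (Multiplicative (ℕ × ℕ)))
        ⟨Multiplicative.ofAdd ((1 : ℕ), (0 : ℕ)), isPrimary_ofAdd_one_zero⟩) :=
    ⟨isPrimary_ofAdd_one_zero, rfl⟩
  obtain ⟨q', hq'1, hq'0⟩ :=
    h (Quotient.mk (primarySetoid (Multiplicative (ℕ × ℕ)))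
        ⟨Multiplicative.ofAdd ((1 : ℕ), (0 : ℕ)), isPrimary_ofAdd_one_zero⟩)
      (Quotient.mk (primarySetoid (Multiplicative (ℕ × ℕ)))
        ⟨Multiplicative.ofAdd ((1 : ℕ), (0 : ℕ)), isPrimary_ofAdd_one_zero⟩)
      ⟨_, hmem, by
        change pull (constMonoidOn (Multiplicative (ℕ × ℕ))) (𝟙 _) (Multiplicative.ofAdd ((1 : ℕ), (0 : ℕ))) ∈
          Primes.carrier (Quotient.mk (primarySetoid (Multiplicative (ℕ × ℕ)))
            ⟨Multiplicative.ofAdd ((1 : ℕ), (0 : ℕ)), isPrimary_ofAdd_one_zero⟩)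
        rw [pull_id]
        exact hmem⟩
  -- `q'` lies in `e 1 𝔭 = 𝔮` …
  change q' ∈ Primes.carrier (@Equiv.swap _ (Classical.decEq _)
      (Quotient.mk (primarySetoid (Multiplicative (ℕ × ℕ)))
        ⟨Multiplicative.ofAdd ((1 : ℕ), (0 : ℕ)), isPrimary_ofAdd_one_zero⟩)
      (Quotient.mk (primarySetoid (Multiplicative (ℕ × ℕ)))
        ⟨Multiplicative.ofAdd ((0 : ℕ), (1 : ℕ)), isPrimary_ofAdd_zero_one⟩)
      (Quotient.mk (primarySetoid (Multiplicative (ℕ × ℕ)))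
        ⟨Multiplicative.ofAdd ((1 : ℕ), (0 : ℕ)), isPrimary_ofAdd_one_zero⟩)) at hq'1
  rw [@Equiv.swap_apply_left _ (Classical.decEq _)] at hq'1
  -- … and (its pull-back along an identity, i.e. itself) in `e 0 𝔭 = 𝔭`
  change pull (constMonoidOn (Multiplicative (ℕ × ℕ))) (𝟙 _) q' ∈
      Primes.carrier (Quotient.mk (primarySetoid (Multiplicative (ℕ × ℕ)))
        ⟨Multiplicative.ofAdd ((1 : ℕ), (0 : ℕ)), isPrimary_ofAdd_one_zero⟩) at hq'0
  rw [pull_id] at hq'0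
  exact prime_one_zero_ne_prime_zero_one (primes_eq_of_mem_carrier hq'0 hq'1)

/-! ### The universal closure is false; the instance form -/

/-- **The universal closure of the sub-DAG slot `FrdI.T42.PrimesCompatibleAlong` is FALSE** (FACT-LIST F-2651:
a body-head predicate, not a hypothesis).  Binders exactly those of the declaration, universe level `0`.
[cite: MochizukiFrdI2008, Thm. 4.2 (ii) p.80] -/
theorem not_forall_primesCompatibleAlong :
    ¬ ∀ (D₁ : Type) [Category.{0} D₁] (Φ₁ : D₁ᵒᵖ ⥤ CommMonCat.{0}) (C₁ : Type) [Category.{0} C₁]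
        (D₂ : Type) [Category.{0} D₂] (Φ₂ : D₂ᵒᵖ ⥤ CommMonCat.{0}) (C₂ : Type) [Category.{0} C₂]
        (F₁ : C₁ ⥤ ElemFrobenioid Φ₁) (F₂ : C₂ ⥤ ElemFrobenioid Φ₂) (Ψ : C₁ ≌ C₂)
        (e : ∀ A : C₁, Primes (Φ₁.obj (op (PreFrobenioid.baseObj F₁ A))) ≃
          Primes (Φ₂.obj (op (PreFrobenioid.baseObj F₂ (Ψ.functor.obj A)))))
        (A A' : C₁) (γ : A ⟶ A'),
        Literature.AlgebraicGeometry.Frobenioids.FrdI.T42.PrimesCompatibleAlong F₁ F₂ Ψ e γ :=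
  fun h => not_primesCompatibleAlong_junk (h _ _ _ _ _ _ _ _ _ _ _ _ _)

/-- **Census of F-2651**: the closure is false, while the instance form of record HOLDS: in the setting of
Theorem 4.2, every family `e` satisfying the clause of row L08 is compatible along every pull-back morphism
(`FrdI.T42.primesCompatibleAlong_of_isPullbackMorphism`, restated here BY NAME as an implication).
[cite: MochizukiFrdI2008, Thm. 4.2 (ii) p.81] -/
theorem primesCompatibleAlong_schema_census {D₁ : Type} [Category.{0} D₁] {Φ₁ : D₁ᵒᵖ ⥤ CommMonCat.{0}}
    {C₁ : Type} [Category.{0} C₁] {D₂ : Type} [Category.{0} D₂] {Φ₂ : D₂ᵒᵖ ⥤ CommMonCat.{0}}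
    {C₂ : Type} [Category.{0} C₂] {F₁ : C₁ ⥤ ElemFrobenioid Φ₁} {F₂ : C₂ ⥤ ElemFrobenioid Φ₂}
    {Ψ : C₁ ≌ C₂} (S : Setting F₁ F₂ Ψ)
    (e : ∀ A : C₁, Primes (Φ₁.obj (op (PreFrobenioid.baseObj F₁ A))) ≃
      Primes (Φ₂.obj (op (PreFrobenioid.baseObj F₂ (Ψ.functor.obj A)))))
    (he : ∀ (A : C₁) ⦃E : C₁⦄ (ε : E ⟶ A) (hε : PreFrobenioid.IsPrimaryPreStep F₁ ε)
      (𝔭 : Primes (Φ₁.obj (op (PreFrobenioid.baseObj F₁ A)))),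
      PreFrobenioid.invDiv F₁ ε hε.1.2 ∈ 𝔭.carrier →
        ∀ h₂ : PreFrobenioid.IsBaseIso F₂ (Ψ.functor.map ε),
          PreFrobenioid.invDiv F₂ (Ψ.functor.map ε) h₂ ∈ (e A 𝔭).carrier)
    {A A' : C₁} (γ : A ⟶ A') (hγ : PreFrobenioid.IsPullbackMorphism F₁ γ) :
    (¬ ∀ (D₁ : Type) [Category.{0} D₁] (Φ₁ : D₁ᵒᵖ ⥤ CommMonCat.{0}) (C₁ : Type) [Category.{0} C₁]
        (D₂ : Type) [Category.{0} D₂] (Φ₂ : D₂ᵒᵖ ⥤ CommMonCat.{0}) (C₂ : Type) [Category.{0} C₂]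
        (F₁ : C₁ ⥤ ElemFrobenioid Φ₁) (F₂ : C₂ ⥤ ElemFrobenioid Φ₂) (Ψ : C₁ ≌ C₂)
        (e : ∀ A : C₁, Primes (Φ₁.obj (op (PreFrobenioid.baseObj F₁ A))) ≃
          Primes (Φ₂.obj (op (PreFrobenioid.baseObj F₂ (Ψ.functor.obj A)))))
        (A A' : C₁) (γ : A ⟶ A'),
        Literature.AlgebraicGeometry.Frobenioids.FrdI.T42.PrimesCompatibleAlong F₁ F₂ Ψ e γ) ∧
      PrimesCompatibleAlong F₁ F₂ Ψ e γ :=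
  ⟨not_forall_primesCompatibleAlong, primesCompatibleAlong_of_isPullbackMorphism S e he γ hγ⟩

end FrdI.T42

end Literature.AlgebraicGeometry.Frobenioids

end
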